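import Mathlib
import Literature.NumberTheory.Sieve.Maynard2016CoupledBoxW
import Literature.NumberTheory.Sieve.Maynard2016KernelPolylogW
import HarnessLib

/-!
# Maynard (2016), Lemma 7: the crude polylog bound for the weighted kernel `K^w` at the frequencies

Topic `Literature/NumberTheory/Sieve`; trunk AntSieve / parity (Maynard 2016 large-gaps ladder, named
fact `Literature.NumberTheory.Sieve.Maynard2016.Lemma7Tuple` of `Maynard2016Lemma7PerTuple.lean`).

J. Maynard, *Large gaps between primes*, Ann. of Math. (2) 183 (2016), 915–933 = arXiv:1408.5110,
§6, display (6.11) ("`∏_p K_p ≪ (log x)^{O_k(1)}`") for the weighted kernel of Lemma 7 (6.32):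
the analogue of `Maynard2016.eventually_norm_logpow_mul_kernel_le` (`Maynard2016KernelPolylog`) for
`coupledFreqKernelW w (P_w) m M x y'` with a general denominator weight (`IsLcmWeight w`, e.g. `1/φ`)
and general finite index types (Lemma 7 has `k − 1` slots on each side): eventually in `x : ℕ`,
uniformly in `m`, `M`, `1 < y' ≤ x` and the frequencies,
`‖(log x)^{k₁} (log y')^{k₂} K^w‖ ≤ (2 log x)^{2(3k₁+3k₂+9k₁k₂)} (log x)^{k₁+k₂}`
(from `LcmEuler.norm_coupledKernelW_le_zetaR_pow` and `ζ(1 + 1/log x) ≤ 2 log x`).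

## References

* J. Maynard, *Large gaps between primes*, Ann. of Math. (2) 183 (2016), 915–933; arXiv:1408.5110,
  §6, (6.11) and (6.32). [Maynard2016LargeGaps]
-/

noncomputable section

open MeasureTheory Filter Finset Real
open scoped BigOperators Topology Classical

namespace Literature.NumberTheory.Sieve

namespace Maynard2016

open LcmEuler

/-- **The crude bound for the weighted coupled kernel**: eventually in `x : ℕ`, for ALL `m`, all
coupling data `M`, all `1 < y' ≤ x` and all frequencies,
`‖(log x)^{k₁} (log y')^{k₂} K^w(ξ,ξ',τ,τ')‖ ≤ (2 log x)^{2·crudeExp k₁ k₂} (log x)^{k₁+k₂}`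
(`K^w = coupledFreqKernelW w (P_w) m M x y'`, `k₁ = #ι`, `k₂ = #κ`; `ζ(1 + 1/log x) ≤ 2 log x`).
[cite: Maynard2016LargeGaps, §6 displays (6.11), (6.32)] -/
theorem eventually_norm_logpow_mul_kernelW_le {ι κ : Type*} [Fintype ι] [DecidableEq ι] [Fintype κ]
    [DecidableEq κ] {w : ℕ → ℂ} (hw : IsLcmWeight w) :
    ∀ᶠ x : ℕ in atTop, ∀ (m : ℕ) (M : ℕ → Finset (ι × κ)) (y' : ℝ), 1 < y' → y' ≤ x →
      ∀ p : (ι → ℝ × ℝ) × (κ → ℝ × ℝ),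
        ‖(Real.log x : ℂ) ^ Fintype.card ι * (Real.log y' : ℂ) ^ Fintype.card κ *
            coupledFreqKernelW w (Pw x) m M (x : ℝ) y' p‖ ≤
          (2 * Real.log x) ^ (2 * crudeExp (Fintype.card ι) (Fintype.card κ)) *
            (Real.log x) ^ (Fintype.card ι + Fintype.card κ) := by
  obtain ⟨δ₀, hδ₀, hζ⟩ := exists_delta_zetaR_le
  have hT : Tendsto (fun x : ℕ => Real.log (x : ℝ)) atTop atTop :=
    Real.tendsto_log_atTop.comp tendsto_natCast_atTop_atTop
  filter_upwards [eventually_gt_atTop 1,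
    (tendsto_inv_atTop_zero.comp hT).eventually_lt_const hδ₀] with x hx hσδ
  intro m M y' hy1 hyx p
  have hx1 : (1 : ℝ) < x := by exact_mod_cast hx
  have hL : 0 < Real.log x := Real.log_pos hx1
  have hly : 0 < Real.log y' := Real.log_pos hy1
  have hlyx : Real.log y' ≤ Real.log x := Real.log_le_log (by linarith) hyx
  set σ : ℝ := 1 / Real.log x with hσ
  have hσ0 : 0 < σ := by positivity
  have hσδ' : σ < δ₀ := by rw [hσ, one_div]; exact hσδ
  have habσ : ∀ i, σ ≤ (expA (x : ℝ) p.1 i).re ∧ σ ≤ (expB (x : ℝ) p.1 i).re := fun i => by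
    rw [(expA_re_expB_re (x : ℝ) p.1 i).1, (expA_re_expB_re (x : ℝ) p.1 i).2]
    exact ⟨hσ.le, hσ.le⟩
  have hab'σ : ∀ j, σ ≤ (expA y' p.2 j).re ∧ σ ≤ (expB y' p.2 j).re := fun j => by
    rw [(expA_re_expB_re y' p.2 j).1, (expA_re_expB_re y' p.2 j).2, hσ]
    exact ⟨one_div_le_one_div_of_le hly hlyx, one_div_le_one_div_of_le hly hlyx⟩
  have hK : ‖coupledFreqKernelW w (Pw x) m M (x : ℝ) y' p‖ ≤
      zetaR (1 + σ) ^ (2 * crudeExp (Fintype.card ι) (Fintype.card κ)) :=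
    norm_coupledKernelW_le_zetaR_pow hw (W := Pw x) m M hσ0 habσ hab'σ
  have hz : zetaR (1 + σ) ≤ 2 * Real.log x := by
    have h := hζ σ hσ0 hσδ'
    have e : (2 : ℝ) / σ = 2 * Real.log x := by rw [hσ]; field_simp
    rwa [e] at h
  have hz0 : 0 ≤ zetaR (1 + σ) := zetaR_nonneg _
  rw [norm_mul, norm_mul, norm_pow, norm_pow, Complex.norm_real, Complex.norm_real,
    Real.norm_eq_abs, Real.norm_eq_abs, abs_of_pos hL, abs_of_pos hly]
  calc Real.log x ^ Fintype.card ι * Real.log y' ^ Fintype.card κ *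
        ‖coupledFreqKernelW w (Pw x) m M (x : ℝ) y' p‖
      ≤ Real.log x ^ Fintype.card ι * Real.log x ^ Fintype.card κ *
          zetaR (1 + σ) ^ (2 * crudeExp (Fintype.card ι) (Fintype.card κ)) := by
        refine mul_le_mul (mul_le_mul_of_nonneg_left (pow_le_pow_left₀ hly.le hlyx _)
          (by positivity)) hK (norm_nonneg _) (by positivity)
    _ ≤ Real.log x ^ Fintype.card ι * Real.log x ^ Fintype.card κ *
          (2 * Real.log x) ^ (2 * crudeExp (Fintype.card ι) (Fintype.card κ)) := by
        gcongr
    _ = (2 * Real.log x) ^ (2 * crudeExp (Fintype.card ι) (Fintype.card κ)) *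
          Real.log x ^ (Fintype.card ι + Fintype.card κ) := by ring

end Maynard2016

end Literature.NumberTheory.Sieve

end
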